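import Summits.MatrixMultiplication.Statement
import Summits.MatrixMultiplication.MatrixMultiplication.Theorems.AsymptoticSpectrumMonotone

/-!
# MatrixMultiplication / AsymptoticSpectrum — Kronecker submultiplicativity

Route `MatrixMultiplication/AsymptoticSpectrum`, item `stmt-MatrixMultiplication-0584` (rank 4):
`R(⟨nm,nm,nm⟩) ≤ R(⟨n,n,n⟩)·R(⟨m,m,m⟩)` over any field (indeed any commutative semiring):
the Kronecker product (written here as an explicit coordinate function, no new definition) of
triad decompositions is a triad decomposition
(`R(t ⊗ t') ≤ R(t)·R(t')`, Bürgisser–Clausen–Shokrollahi 1997, Prop. 14.23; Bläser 2013, §5),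
and `⟨n,n,n⟩ ⊗ ⟨m,m,m⟩ ≅ ⟨nm,nm,nm⟩` via `Fin n × Fin m ≃ Fin (n·m)`.
-/

noncomputable section

open scoped BigOperators

namespace Literature.CplxAlg

universe u v₁ v₂ v₃ w₁ w₂ w₃

section Kronecker

variable {K : Type u} [CommSemiring K] {ι : Type v₁} {κ : Type v₂} {μ : Type v₃}
  {ι' : Type w₁} {κ' : Type w₂} {μ' : Type w₃}

/-- An optimal decomposition: if `t` has some finite triad decomposition then it has one with
exactly `R(t)` triads. [cite: Blaser2013, §4] -/
theorem exists_eq_sum_triad_tensorRank (t : ι → κ → μ → K)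
    (hne : ∃ (r : ℕ) (w : Fin r → ι → K) (u : Fin r → κ → K) (v : Fin r → μ → K),
      t = ∑ i, Literature.Computability.AlgebraicComplexity.triad (w i) (u i) (v i)) :
    ∃ (w : Fin (Literature.Computability.AlgebraicComplexity.tensorRank t) → ι → K) (u : Fin (Literature.Computability.AlgebraicComplexity.tensorRank t) → κ → K)
      (v : Fin (Literature.Computability.AlgebraicComplexity.tensorRank t) → μ → K), t = ∑ i, Literature.Computability.AlgebraicComplexity.triad (w i) (u i) (v i) := by
  obtain ⟨r, w, u, v, e⟩ := hne
  exact Nat.sInf_mem (s := {r : ℕ | ∃ (w : Fin r → ι → K) (u : Fin r → κ → K)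
    (v : Fin r → μ → K), t = ∑ i, Literature.Computability.AlgebraicComplexity.triad (w i) (u i) (v i)}) ⟨r, w, u, v, e⟩

/-- `R(t ⊗ t') ≤ R(t)·R(t')` (Bürgisser–Clausen–Shokrollahi 1997, Prop. 14.23), for tensors
admitting finite decompositions. [cite: BurgisserClausenShokrollahi1997, Prop. 14.23] -/
theorem tensorRank_kroneckerTensor_le (t : ι → κ → μ → K) (t' : ι' → κ' → μ' → K)
    (hne : ∃ (r : ℕ) (w : Fin r → ι → K) (u : Fin r → κ → K) (v : Fin r → μ → K),
      t = ∑ i, Literature.Computability.AlgebraicComplexity.triad (w i) (u i) (v i))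
    (hne' : ∃ (r : ℕ) (w : Fin r → ι' → K) (u : Fin r → κ' → K) (v : Fin r → μ' → K),
      t' = ∑ i, Literature.Computability.AlgebraicComplexity.triad (w i) (u i) (v i)) :
    Literature.Computability.AlgebraicComplexity.tensorRank (fun (a : ι × ι') (b : κ × κ') (c : μ × μ') => t a.1 b.1 c.1 * t' a.2 b.2 c.2) ≤
      Literature.Computability.AlgebraicComplexity.tensorRank t * Literature.Computability.AlgebraicComplexity.tensorRank t' := by
  classical
  obtain ⟨w, u, v, e⟩ := exists_eq_sum_triad_tensorRank t hne
  obtain ⟨w', u', v', e'⟩ := exists_eq_sum_triad_tensorRank t' hne'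
  have h := Literature.Computability.AlgebraicComplexity.tensorRank_le_card_of_eq_sum
    (t := fun (a : ι × ι') (b : κ × κ') (c : μ × μ') => t a.1 b.1 c.1 * t' a.2 b.2 c.2)
    (σ := Fin (Literature.Computability.AlgebraicComplexity.tensorRank t) × Fin (Literature.Computability.AlgebraicComplexity.tensorRank t'))
    (fun p a => w p.1 a.1 * w' p.2 a.2) (fun p b => u p.1 b.1 * u' p.2 b.2)
    (fun p c => v p.1 c.1 * v' p.2 c.2) ?_
  · simpa [Fintype.card_prod] using h
  · funext a b c
    conv_lhs => rw [e, e']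
    simp only [Finset.sum_apply, Literature.Computability.AlgebraicComplexity.triad_apply]
    rw [Finset.sum_mul_sum, Fintype.sum_prod_type]
    refine Finset.sum_congr rfl fun i _ => Finset.sum_congr rfl fun j _ => ?_
    ring

end Kronecker

section MatMul

variable (K : Type u) [CommSemiring K]

/-- `⟨nm,nm,nm⟩` is the restriction of `⟨n,n,n⟩ ⊗ ⟨m,m,m⟩` along `Fin (n·m) ≃ Fin n × Fin m`
on every coordinate. [cite: Blaser2013, §5] -/
theorem matMulTensor_mul_eq_comp_kronecker (n m : ℕ) :
    let f : Fin (n * m) → Fin n × Fin m := (finProdFinEquiv (m := n) (n := m)).symm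
    let E : Fin (n * m) × Fin (n * m) → (Fin n × Fin n) × (Fin m × Fin m) :=
      fun a => (((f a.1).1, (f a.2).1), ((f a.1).2, (f a.2).2))
    Literature.Computability.AlgebraicComplexity.matMulTensor K (n * m) (n * m) (n * m) = fun a b c =>
      (fun (x : (Fin n × Fin n) × (Fin m × Fin m)) (y : (Fin n × Fin n) × (Fin m × Fin m))
          (z : (Fin n × Fin n) × (Fin m × Fin m)) =>
        Literature.Computability.AlgebraicComplexity.matMulTensor K n n n x.1 y.1 z.1 * Literature.Computability.AlgebraicComplexity.matMulTensor K m m m x.2 y.2 z.2) (E a) (E b) (E c) := by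
  intro f E
  funext a b c
  have key : ∀ x y : Fin (n * m), x = y ↔ (f x).1 = (f y).1 ∧ (f x).2 = (f y).2 := fun x y => by
    rw [← Prod.ext_iff]
    exact (finProdFinEquiv.symm.injective.eq_iff).symm
  simp only [Literature.Computability.AlgebraicComplexity.matMulTensor, E, key]
  by_cases h₁ : (f a.1).1 = (f b.1).1 ∧ (f b.2).1 = (f c.1).1 ∧ (f a.2).1 = (f c.2).1 <;>
    by_cases h₂ : (f a.1).2 = (f b.1).2 ∧ (f b.2).2 = (f c.1).2 ∧ (f a.2).2 = (f c.2).2 <;>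
    simp only [h₁, h₂, if_false, mul_zero] <;> split_ifs with h <;> simp_all

/-- Settles `stmt-MatrixMultiplication-0584` (over any commutative semiring): Kronecker
submultiplicativity `R(⟨nm,nm,nm⟩) ≤ R(⟨n,n,n⟩)·R(⟨m,m,m⟩)`.
[cite: BurgisserClausenShokrollahi1997, Prop. 14.23] -/
theorem tensorRank_matMulTensor_mul_le (n m : ℕ) :
    Literature.Computability.AlgebraicComplexity.tensorRank (Literature.Computability.AlgebraicComplexity.matMulTensor K (n * m) (n * m) (n * m)) ≤
      Literature.Computability.AlgebraicComplexity.tensorRank (Literature.Computability.AlgebraicComplexity.matMulTensor K n n n) * Literature.Computability.AlgebraicComplexity.tensorRank (Literature.Computability.AlgebraicComplexity.matMulTensor K m m m) := by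
  classical
  rw [matMulTensor_mul_eq_comp_kronecker K n m]
  refine (tensorRank_comp_le
    (fun (x : (Fin n × Fin n) × (Fin m × Fin m)) (y : (Fin n × Fin n) × (Fin m × Fin m))
        (z : (Fin n × Fin n) × (Fin m × Fin m)) =>
      Literature.Computability.AlgebraicComplexity.matMulTensor K n n n x.1 y.1 z.1 * Literature.Computability.AlgebraicComplexity.matMulTensor K m m m x.2 y.2 z.2) _ _ _
    (exists_eq_sum_triad _)).trans ?_
  exact tensorRank_kroneckerTensor_le (Literature.Computability.AlgebraicComplexity.matMulTensor K n n n) (Literature.Computability.AlgebraicComplexity.matMulTensor K m m m)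
    (exists_eq_sum_triad _) (exists_eq_sum_triad _)

/-- `stmt-MatrixMultiplication-0584`, exact signature (fields). [cite: BurgisserClausenShokrollahi1997, Prop. 14.23] -/
theorem tensorRank_matMulTensor_kronecker_submult :
    ∀ (K : Type) [Field K] (n m : ℕ),
      Literature.Computability.AlgebraicComplexity.tensorRank (Literature.Computability.AlgebraicComplexity.matMulTensor K (n * m) (n * m) (n * m)) ≤
        Literature.Computability.AlgebraicComplexity.tensorRank (Literature.Computability.AlgebraicComplexity.matMulTensor K n n n) *
          Literature.Computability.AlgebraicComplexity.tensorRank (Literature.Computability.AlgebraicComplexity.matMulTensor K m m m) :=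
  fun K _ n m => tensorRank_matMulTensor_mul_le K n m

end MatMul

end Literature.CplxAlg
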